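import Mathlib
import Summits.ValiantsHypothesis.ValiantsHypothesis.Theorems.NewtonUnitEquationsDissociatedUniformTotalsLawHexagon
import Summits.ValiantsHypothesis.ValiantsHypothesis.Theorems.NewtonUnitEquationsDissociatedUniformTotalsLawLeftTurning
import HarnessLib

/-!
# Crux `NewtonUnitEquations.DissociatedUniform` (stmt-ValiantsHypothesis-5905): a CHECKABLE CRITERION for the convexly ordered
# and smooth strata — strict convex position in the listed order implies `ConvexlyOrdered`

All stratum theorems of the `n = 3` totals-law programme (`…TotalsLawUnimodal*`, `…LeftTurning`, `…Hodograph*`, `…TripleChains`)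
are stated under `ConvexlyOrdered a` (every linear functional is cyclically unimodal along the labelling) or its hodograph form
`ConvexlyOrdered (edgeVec a)` (the SMOOTH stratum).  So far the tree could verify these hypotheses only for NAMED families
(parabolas, graphs of convex sequences, sampled circles, affine images).  This file supplies the general, decidable-on-data
criterion:

* `StrictlyConvexCcw a` : every other vertex lies strictly to the LEFT of each directed edge `a z → a (z+1)` (the usual
  definition of a strictly convex polygon listed counter-clockwise; `q(q-2)` sign conditions), `StrictlyConvexCw a` its mirror;
* `isLocalMax_lt` : under `StrictlyConvexCcw`, a weak local maximum `i` of a NON-ZERO functional `⟨w, a ·⟩` strictly beats every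
  vertex other than `i - 1, i, i + 1` (the functional lies in the normal cone at `a i`; coordinates in the positively oriented
  basis of the two incident edges);
* **`convexlyOrdered_of_strictlyConvexCcw`** / **`_of_strictlyConvexCw`** (`q ≥ 3`): strict convex position in the listed order
  implies `ConvexlyOrdered` (from a global minimum the values climb monotonically to a global maximum and descend back: a first
  descent/ascent out of turn would be a local extremum that is not global);
* `leftTurning_of_strictlyConvexCcw`, `rightTurning_of_strictlyConvexCw` (link to `…LeftTurning`), and the smooth-stratum form
  `convexlyOrdered_edgeVec_of_strictlyConvex` (apply the criterion to the hodograph polygon `z ↦ a (z+1) - a z`);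
* integer data: `strictlyConvexCcw_intCurve` / `strictlyConvexCw_intCurve` reduce the hypothesis for a curve with integer
  coordinates to a `decide`-able statement over `ℤ`.
Honest label: infrastructure for census-by-name and kernel witnesses on the convexly ordered / smooth strata; no law is proved
here; nothing bears on VP ≠ VNP.
[folklore: a strictly convex polygon traversed along its boundary is met by every linear functional unimodally]
-/

set_option linter.dupNamespace false -- `ValiantsHypothesis.ValiantsHypothesis` (summit = problem) in every name

open scoped BigOperators

namespace Summit.ValiantsHypothesis.ValiantsHypothesis.Theorems.NewtonUnitEquationsDissociatedUniform

namespace TotalsLaw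

open Matrix

section ConvexPosition

variable {q : ℕ} [NeZero q]

/-- STRICT CONVEX POSITION, COUNTER-CLOCKWISE in the listed order: for every edge `a z → a (z + 1)` every other vertex `a x`
lies strictly to its left (`det(a(z+1) − a z, a x − a z) > 0`). -/
def StrictlyConvexCcw (a : ZMod q → (Fin 2 → ℝ)) : Prop :=
  ∀ z x : ZMod q, x ≠ z → x ≠ z + 1 → 0 < cross2 (a (z + 1) - a z) (a x - a z)

/-- STRICT CONVEX POSITION, CLOCKWISE in the listed order (every other vertex strictly to the right of each edge). -/
def StrictlyConvexCw (a : ZMod q → (Fin 2 → ℝ)) : Prop :=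
  ∀ z x : ZMod q, x ≠ z → x ≠ z + 1 → cross2 (a (z + 1) - a z) (a x - a z) < 0

omit [NeZero q] in
/-- `1 ≠ 0` in `ZMod q` for `q ≥ 3`. [folklore] -/
theorem one_ne_zero_of_three_le (hq : 3 ≤ q) : (1 : ZMod q) ≠ 0 := by
  intro h
  have h1 : ((1 : ℕ) : ZMod q) = 0 := by exact_mod_cast h
  rw [ZMod.natCast_eq_zero_iff] at h1
  exact absurd (Nat.le_of_dvd (by norm_num) h1) (by omega)

omit [NeZero q] in
/-- `2 ≠ 0` in `ZMod q` for `q ≥ 3`. [folklore] -/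
theorem two_ne_zero_of_three_le (hq : 3 ≤ q) : (2 : ZMod q) ≠ 0 := by
  intro h
  have h2 : ((2 : ℕ) : ZMod q) = 0 := by exact_mod_cast h
  rw [ZMod.natCast_eq_zero_iff] at h2
  exact absurd (Nat.le_of_dvd (by norm_num) h2) (by omega)

omit [NeZero q] in
/-- Plane linear algebra: in the basis of two vectors `e₁, e₂` with `det(e₁,e₂) ≠ 0`,
`det(e₁,e₂)·⟨w, v⟩ = det(v,e₂)·⟨w,e₁⟩ + det(e₁,v)·⟨w,e₂⟩`. [folklore] -/
theorem cross2_mul_dotProduct (w e₁ e₂ v : Fin 2 → ℝ) :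
    cross2 e₁ e₂ * (w ⬝ᵥ v) = cross2 v e₂ * (w ⬝ᵥ e₁) + cross2 e₁ v * (w ⬝ᵥ e₂) := by
  simp only [cross2, dotProduct, Fin.sum_univ_two]; ring

omit [NeZero q] in
/-- A functional vanishing on two independent plane vectors is zero (coordinate form). [folklore] -/
theorem eq_zero_of_dotProduct_eq_zero {w e₁ e₂ : Fin 2 → ℝ} (h12 : cross2 e₁ e₂ ≠ 0) (h1 : w ⬝ᵥ e₁ = 0)
    (h2 : w ⬝ᵥ e₂ = 0) : w = 0 := by
  have k0 : w 0 * cross2 e₁ e₂ = (w ⬝ᵥ e₁) * e₂ 1 - (w ⬝ᵥ e₂) * e₁ 1 := by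
    simp only [cross2, dotProduct, Fin.sum_univ_two]; ring
  have k1 : w 1 * cross2 e₁ e₂ = (w ⬝ᵥ e₂) * e₁ 0 - (w ⬝ᵥ e₁) * e₂ 0 := by
    simp only [cross2, dotProduct, Fin.sum_univ_two]; ring
  rw [h1, h2] at k0 k1
  have h0' : w 0 = 0 := by
    have : w 0 * cross2 e₁ e₂ = 0 := by rw [k0]; ring
    exact (mul_eq_zero.1 this).resolve_right h12
  have h1' : w 1 = 0 := by
    have : w 1 * cross2 e₁ e₂ = 0 := by rw [k1]; ring
    exact (mul_eq_zero.1 this).resolve_right h12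
  ext t; fin_cases t
  · exact h0'
  · exact h1'

omit [NeZero q] in
/-- **Normal-cone lemma.**  Under strict ccw convex position, if `i` is a weak local maximum of `x ↦ ⟨w, a x⟩` (`w ≠ 0`) then every
vertex other than `i - 1, i, i + 1` has strictly smaller value. [folklore] -/
theorem isLocalMax_lt {a : ZMod q → (Fin 2 → ℝ)} (ha : StrictlyConvexCcw a) (hq : 3 ≤ q) {w : Fin 2 → ℝ} (hw : w ≠ 0)
    {i : ZMod q} (hl : w ⬝ᵥ a (i - 1) ≤ w ⬝ᵥ a i) (hr : w ⬝ᵥ a (i + 1) ≤ w ⬝ᵥ a i) {x : ZMod q} (hx0 : x ≠ i - 1)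
    (hx1 : x ≠ i) (hx2 : x ≠ i + 1) : w ⬝ᵥ a x < w ⬝ᵥ a i := by
  -- the two incident edges
  set e₁ : Fin 2 → ℝ := a i - a (i - 1) with he₁
  set e₂ : Fin 2 → ℝ := a (i + 1) - a i with he₂
  set v : Fin 2 → ℝ := a x - a i with hv
  have h2ne : (2 : ZMod q) ≠ 0 := two_ne_zero_of_three_le hq
  have h1ne : (1 : ZMod q) ≠ 0 := one_ne_zero_of_three_le hq
  -- det(e₁, e₂) > 0 : the vertex i+1 is left of the edge (i-1 → i)
  have h12 : 0 < cross2 e₁ e₂ := by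
    have h := ha (i - 1) (i + 1) (fun h => h2ne (by linear_combination h)) (fun h => h1ne (by linear_combination h))
    rw [sub_add_cancel] at h
    have : cross2 (a i - a (i - 1)) (a (i + 1) - a (i - 1)) = cross2 e₁ e₂ := by
      rw [he₁, he₂]; simp only [cross2, Pi.sub_apply]; ring
    rwa [this] at h
  -- x is left of both incident edges
  have hx_e₂ : 0 < cross2 e₂ v := ha i x hx1 hx2
  have hx_e₁ : 0 < cross2 e₁ v := by
    have h := ha (i - 1) x hx0 (by rw [sub_add_cancel]; exact hx1)
    rw [sub_add_cancel] at h
    have : cross2 (a i - a (i - 1)) (a x - a (i - 1)) = cross2 e₁ v + cross2 e₁ e₁ := by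
      rw [he₁, hv]; simp only [cross2, Pi.sub_apply]; ring
    rw [this, cross2_self, add_zero] at h
    exact h
  -- the functional in the normal cone: ⟨w,e₁⟩ ≥ 0 ≥ ⟨w,e₂⟩
  have hw1 : 0 ≤ w ⬝ᵥ e₁ := by rw [he₁, dotProduct_sub]; linarith
  have hw2 : w ⬝ᵥ e₂ ≤ 0 := by rw [he₂, dotProduct_sub]; linarith
  have key := cross2_mul_dotProduct w e₁ e₂ v
  have hxe2' : cross2 v e₂ < 0 := by rw [cross2_swap]; linarith
  -- ⟨w, v⟩ ≤ 0, and = 0 forces w = 0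
  have hle : cross2 e₁ e₂ * (w ⬝ᵥ v) ≤ 0 := by
    rw [key]; nlinarith
  have hv_le : w ⬝ᵥ v ≤ 0 := by
    by_contra h
    rw [not_le] at h
    have := mul_pos h12 h
    linarith
  have hv_lt : w ⬝ᵥ v < 0 := by
    refine lt_of_le_of_ne hv_le fun h0 => hw ?_
    have hsum : cross2 v e₂ * (w ⬝ᵥ e₁) + cross2 e₁ v * (w ⬝ᵥ e₂) = 0 := by rw [← key, h0, mul_zero]
    have ha1 : w ⬝ᵥ e₁ = 0 := by nlinarith
    have ha2 : w ⬝ᵥ e₂ = 0 := by nlinarith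
    exact eq_zero_of_dotProduct_eq_zero h12.ne' ha1 ha2
  have : w ⬝ᵥ a x - w ⬝ᵥ a i = w ⬝ᵥ v := by rw [hv, dotProduct_sub]
  linarith

omit [NeZero q] in
/-- Mirror image: under strict ccw convex position a weak local MINIMUM of a non-zero functional is strictly below every vertex
other than its two neighbours (apply `isLocalMax_lt` to `-w`). [folklore] -/
theorem isLocalMin_gt {a : ZMod q → (Fin 2 → ℝ)} (ha : StrictlyConvexCcw a) (hq : 3 ≤ q) {w : Fin 2 → ℝ} (hw : w ≠ 0)
    {i : ZMod q} (hl : w ⬝ᵥ a i ≤ w ⬝ᵥ a (i - 1)) (hr : w ⬝ᵥ a i ≤ w ⬝ᵥ a (i + 1)) {x : ZMod q} (hx0 : x ≠ i - 1)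
    (hx1 : x ≠ i) (hx2 : x ≠ i + 1) : w ⬝ᵥ a i < w ⬝ᵥ a x := by
  have hw' : -w ≠ 0 := fun h => hw (neg_eq_zero.1 h)
  have h := isLocalMax_lt ha hq hw' (i := i) (by rw [neg_dotProduct, neg_dotProduct]; linarith)
    (by rw [neg_dotProduct, neg_dotProduct]; linarith) hx0 hx1 hx2
  rw [neg_dotProduct, neg_dotProduct] at h
  linarith

omit [NeZero q] in
/-- Cast bookkeeping: `n + ↑(k+1) = n + ↑k + 1`. [folklore] -/
theorem add_natCast_succ (n : ZMod q) (k : ℕ) : n + ((k + 1 : ℕ) : ZMod q) = n + (k : ZMod q) + 1 := by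
  push_cast; ring

omit [NeZero q] in
/-- Cast bookkeeping: `n + ↑(k-1) = n + ↑k - 1` for `1 ≤ k`. [folklore] -/
theorem add_natCast_pred (n : ZMod q) {k : ℕ} (hk : 1 ≤ k) : n + ((k - 1 : ℕ) : ZMod q) = n + (k : ZMod q) - 1 := by
  rw [Nat.cast_sub hk]; push_cast; ring

omit [NeZero q] in
/-- Two small naturals with equal casts are equal. [folklore] -/
theorem nat_eq_of_cast_eq {k m : ℕ} (hk : k < q) (hm : m < q) (h : (k : ZMod q) = (m : ZMod q)) : k = m := by
  have h' := congrArg ZMod.val h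
  rwa [ZMod.val_cast_of_lt hk, ZMod.val_cast_of_lt hm] at h'

omit [NeZero q] in
/-- **Ascent step.**  With `n` a global minimum and `n + d` a global maximum of `x ↦ ⟨w, a x⟩` (`w ≠ 0`, strict ccw convex
position), if the values are non-decreasing along `n, n+1, …, n+k` (`k < d`) then also `⟨w, a(n+k)⟩ ≤ ⟨w, a(n+k+1)⟩`: otherwise
`n + k` would be a weak local maximum strictly above the global maximum `n + d`. [folklore] -/
theorem ascent_step {a : ZMod q → (Fin 2 → ℝ)} (ha : StrictlyConvexCcw a) (hq : 3 ≤ q) {w : Fin 2 → ℝ} (hw : w ≠ 0)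
    {n : ZMod q} {d : ℕ} (hdq : d < q) (hmin : ∀ x, w ⬝ᵥ a n ≤ w ⬝ᵥ a x) (hmax : ∀ x, w ⬝ᵥ a x ≤ w ⬝ᵥ a (n + (d : ZMod q)))
    {k : ℕ} (hk : k < d) (ih : ∀ m, m < k → w ⬝ᵥ a (n + (m : ZMod q)) ≤ w ⬝ᵥ a (n + ((m + 1 : ℕ) : ZMod q))) :
    w ⬝ᵥ a (n + (k : ZMod q)) ≤ w ⬝ᵥ a (n + ((k + 1 : ℕ) : ZMod q)) := by
  by_contra hlt
  rw [not_le] at hlt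
  rcases Nat.eq_zero_or_pos k with rfl | hkpos
  · -- `k = 0`: the successor of the minimum cannot be lower
    have := hmin (n + ((0 + 1 : ℕ) : ZMod q))
    simp only [Nat.cast_zero, add_zero] at hlt
    exact absurd hlt (not_lt.2 this)
  -- `n + k` is a weak local maximum
  have hprev : w ⬝ᵥ a (n + (k : ZMod q) - 1) ≤ w ⬝ᵥ a (n + (k : ZMod q)) := by
    have h := ih (k - 1) (by omega)
    rwa [Nat.sub_add_cancel hkpos, add_natCast_pred n hkpos] at h
  have hnext : w ⬝ᵥ a (n + (k : ZMod q) + 1) ≤ w ⬝ᵥ a (n + (k : ZMod q)) := by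
    rw [← add_natCast_succ]; exact hlt.le
  -- where is the maximum `n + d`?
  by_cases h1 : n + (d : ZMod q) = n + (k : ZMod q) + 1
  · have := hmax (n + (k : ZMod q))
    rw [h1, ← add_natCast_succ] at this
    exact absurd hlt (not_lt.2 this)
  by_cases h2 : n + (d : ZMod q) = n + (k : ZMod q)
  · have : d = k := nat_eq_of_cast_eq hdq (by omega) (add_left_cancel h2)
    omega
  by_cases h3 : n + (d : ZMod q) = n + (k : ZMod q) - 1
  · rw [← add_natCast_pred n hkpos] at h3
    have : d = k - 1 := nat_eq_of_cast_eq hdq (by omega) (add_left_cancel h3)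
    omega
  have := isLocalMax_lt ha hq hw hprev hnext h3 h2 h1
  exact absurd (hmax (n + (k : ZMod q))) (not_le.2 this)

omit [NeZero q] in
/-- **Descent step.**  Symmetric statement after the maximum: if the values are non-increasing along `n+d, …, n+k`
(`d ≤ k`, `k + 1 < q`) then `⟨w, a(n+k+1)⟩ ≤ ⟨w, a(n+k)⟩`: otherwise `n + k` would be a weak local minimum strictly below the global
minimum `n`. [folklore] -/
theorem descent_step {a : ZMod q → (Fin 2 → ℝ)} (ha : StrictlyConvexCcw a) (hq : 3 ≤ q) {w : Fin 2 → ℝ} (hw : w ≠ 0)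
    {n : ZMod q} {d : ℕ} (hmin : ∀ x, w ⬝ᵥ a n ≤ w ⬝ᵥ a x) (hmax : ∀ x, w ⬝ᵥ a x ≤ w ⬝ᵥ a (n + (d : ZMod q)))
    {k : ℕ} (hk : d ≤ k) (hk1 : k + 1 < q)
    (ih : ∀ m, m < k → d ≤ m → w ⬝ᵥ a (n + ((m + 1 : ℕ) : ZMod q)) ≤ w ⬝ᵥ a (n + (m : ZMod q))) :
    w ⬝ᵥ a (n + ((k + 1 : ℕ) : ZMod q)) ≤ w ⬝ᵥ a (n + (k : ZMod q)) := by
  by_contra hlt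
  rw [not_le] at hlt
  rcases Nat.lt_or_ge d k with hdk | hdk
  swap
  · -- `k = d`: the successor of the maximum cannot be higher
    have hkd : k = d := le_antisymm hdk hk
    subst hkd
    exact absurd hlt (not_lt.2 (hmax _))
  have hkpos : 1 ≤ k := by omega
  -- `n + k` is a weak local minimum
  have hprev : w ⬝ᵥ a (n + (k : ZMod q)) ≤ w ⬝ᵥ a (n + (k : ZMod q) - 1) := by
    have h := ih (k - 1) (by omega) (by omega)
    rwa [Nat.sub_add_cancel hkpos, add_natCast_pred n hkpos] at h
  have hnext : w ⬝ᵥ a (n + (k : ZMod q)) ≤ w ⬝ᵥ a (n + (k : ZMod q) + 1) := by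
    rw [← add_natCast_succ]; exact hlt.le
  -- where is the minimum `n`?
  by_cases h1 : n = n + (k : ZMod q) + 1
  · have h0 : ((k + 1 : ℕ) : ZMod q) = 0 := by
      have := h1; push_cast; linear_combination -this
    rw [ZMod.natCast_eq_zero_iff] at h0
    exact absurd (Nat.le_of_dvd (by omega) h0) (by omega)
  by_cases h2 : n = n + (k : ZMod q)
  · have h0 : ((k : ℕ) : ZMod q) = 0 := by have := h2; linear_combination -this
    rw [ZMod.natCast_eq_zero_iff] at h0
    exact absurd (Nat.le_of_dvd (by omega) h0) (by omega)
  by_cases h3 : n = n + (k : ZMod q) - 1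
  · -- `k = 1`, hence `d = 0`: maximum = minimum, the functional is constant
    rw [← add_natCast_pred n hkpos] at h3
    have h0 : ((k - 1 : ℕ) : ZMod q) = 0 := by have := h3; linear_combination -this
    rw [ZMod.natCast_eq_zero_iff] at h0
    have hk1' : k = 1 := by have := Nat.eq_zero_of_dvd_of_lt h0 (by omega); omega
    have hd0 : d = 0 := by omega
    subst hd0
    have hc : w ⬝ᵥ a (n + ((k + 1 : ℕ) : ZMod q)) ≤ w ⬝ᵥ a (n + (k : ZMod q)) := by
      refine (hmax _).trans ?_
      simp only [Nat.cast_zero, add_zero]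
      exact hmin _
    exact absurd hlt (not_lt.2 hc)
  have := isLocalMin_gt ha hq hw hprev hnext h3 h2 h1
  exact absurd (hmin (n + (k : ZMod q))) (not_le.2 this)

/-- **Strict ccw convex position ⇒ convexly ordered** (`q ≥ 3`). [folklore] -/
theorem convexlyOrdered_of_strictlyConvexCcw {a : ZMod q → (Fin 2 → ℝ)} (ha : StrictlyConvexCcw a) (hq : 3 ≤ q) :
    ConvexlyOrdered a := by
  classical
  intro w
  -- a global minimum `n` and a global maximum `i₀`
  obtain ⟨n, -, hn⟩ := Finset.exists_min_image Finset.univ (fun x => w ⬝ᵥ a x) Finset.univ_nonempty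
  obtain ⟨i₀, -, hi₀⟩ := Finset.exists_max_image Finset.univ (fun x => w ⬝ᵥ a x) Finset.univ_nonempty
  have hmin : ∀ x, w ⬝ᵥ a n ≤ w ⬝ᵥ a x := fun x => hn x (Finset.mem_univ _)
  by_cases hw : w = 0
  · -- constant functional
    refine ⟨n, 0, Nat.pos_of_ne_zero (NeZero.ne q), fun k hk => absurd hk (Nat.not_lt_zero _), fun k _ _ => ?_⟩
    simp [hw]
  -- `d` = forward distance from `n` to `i₀`
  set d : ℕ := (i₀ - n).val with hd
  have hdq : d < q := ZMod.val_lt _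
  have hi₀eq : i₀ = n + (d : ZMod q) := by rw [hd, ZMod.natCast_zmod_val]; ring
  have hmax : ∀ x, w ⬝ᵥ a x ≤ w ⬝ᵥ a (n + (d : ZMod q)) := fun x => hi₀eq ▸ hi₀ x (Finset.mem_univ _)
  refine ⟨n, d, hdq, ?_, ?_⟩
  · intro k
    induction k using Nat.strong_induction_on with
    | _ k ih => exact fun hk => ascent_step ha hq hw hdq hmin hmax hk fun m hm => ih m hm (hm.trans hk)
  · intro k
    induction k using Nat.strong_induction_on with
    | _ k ih =>
      exact fun hk hk1 => descent_step ha hq hw hmin hmax hk hk1 fun m hm hdm => ih m hm hdm (by omega)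

/-- Swapping the two coordinates (a reflection). -/
def swapXY (p : Fin 2 → ℝ) : Fin 2 → ℝ := ![p 1, p 0]

/-- The reflection reverses orientations: `cross2 (swap u) (swap v) = - cross2 u v`. [folklore] -/
theorem cross2_swapXY (u v : Fin 2 → ℝ) : cross2 (swapXY u) (swapXY v) = -cross2 u v := by
  simp only [cross2, swapXY, Matrix.cons_val_zero, Matrix.cons_val_one]; ring

/-- The reflection is linear: `swap (u - v) = swap u - swap v`. [folklore] -/
theorem swapXY_sub (u v : Fin 2 → ℝ) : swapXY (u - v) = swapXY u - swapXY v := by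
  ext t; fin_cases t <;> simp [swapXY]

/-- Pairings transform by swapping the weight: `⟨w, p⟩ = ⟨swap w, swap p⟩`. [folklore] -/
theorem dotProduct_swapXY (w p : Fin 2 → ℝ) : swapXY w ⬝ᵥ swapXY p = w ⬝ᵥ p := by
  simp [swapXY, dotProduct, Fin.sum_univ_two]; ring

omit [NeZero q] in
/-- A clockwise strictly convex curve becomes counter-clockwise after the reflection. [folklore] -/
theorem strictlyConvexCcw_swapXY {a : ZMod q → (Fin 2 → ℝ)} (ha : StrictlyConvexCw a) :
    StrictlyConvexCcw fun z => swapXY (a z) := by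
  intro z x hx0 hx1
  have h := ha z x hx0 hx1
  rw [← swapXY_sub, ← swapXY_sub, cross2_swapXY]
  linarith

omit [NeZero q] in
/-- `ConvexlyOrdered` is invariant under the reflection. [folklore] -/
theorem convexlyOrdered_of_swapXY {a : ZMod q → (Fin 2 → ℝ)} (h : ConvexlyOrdered fun z => swapXY (a z)) :
    ConvexlyOrdered a := by
  intro w
  obtain ⟨n, d, hnd⟩ := h (swapXY w)
  refine ⟨n, d, ?_⟩
  have key : (fun x => swapXY w ⬝ᵥ swapXY (a x)) = fun x => w ⬝ᵥ a x := by
    funext x; exact dotProduct_swapXY w (a x)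
  rwa [key] at hnd

/-- **Strict cw convex position ⇒ convexly ordered** (`q ≥ 3`). [folklore] -/
theorem convexlyOrdered_of_strictlyConvexCw {a : ZMod q → (Fin 2 → ℝ)} (ha : StrictlyConvexCw a) (hq : 3 ≤ q) :
    ConvexlyOrdered a :=
  convexlyOrdered_of_swapXY (convexlyOrdered_of_strictlyConvexCcw (strictlyConvexCcw_swapXY ha) hq)

omit [NeZero q] in
/-- Strict ccw convex position implies `LeftTurning` (the case `x = z + 2` of the hypothesis; `q ≥ 3`). [folklore] -/
theorem leftTurning_of_strictlyConvexCcw {a : ZMod q → (Fin 2 → ℝ)} (ha : StrictlyConvexCcw a) (hq : 3 ≤ q) :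
    LeftTurning a := by
  intro z
  have h2ne : (2 : ZMod q) ≠ 0 := two_ne_zero_of_three_le hq
  have h1ne : (1 : ZMod q) ≠ 0 := one_ne_zero_of_three_le hq
  have h := ha z (z + 2) (fun h => h2ne (by linear_combination h)) (fun h => h1ne (by linear_combination h))
  -- det(a(z+1) - a z, a(z+2) - a z) = det(a(z+1) - a z, a(z+2) - a(z+1))
  have e : cross2 (a (z + 1) - a z) (a (z + 2) - a z) =
      (a (z + 1) 0 - a z 0) * (a (z + 2) 1 - a (z + 1) 1) - (a (z + 1) 1 - a z 1) * (a (z + 2) 0 - a (z + 1) 0) := by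
    simp only [cross2, Pi.sub_apply]; ring
  rwa [e] at h

omit [NeZero q] in
/-- Strict cw convex position implies `RightTurning` (`q ≥ 3`). [folklore] -/
theorem rightTurning_of_strictlyConvexCw {a : ZMod q → (Fin 2 → ℝ)} (ha : StrictlyConvexCw a) (hq : 3 ≤ q) :
    RightTurning a := by
  intro z
  have h2ne : (2 : ZMod q) ≠ 0 := two_ne_zero_of_three_le hq
  have h1ne : (1 : ZMod q) ≠ 0 := one_ne_zero_of_three_le hq
  have h := ha z (z + 2) (fun h => h2ne (by linear_combination h)) (fun h => h1ne (by linear_combination h))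
  have e : cross2 (a (z + 1) - a z) (a (z + 2) - a z) =
      (a (z + 1) 0 - a z 0) * (a (z + 2) 1 - a (z + 1) 1) - (a (z + 1) 1 - a z 1) * (a (z + 2) 0 - a (z + 1) 0) := by
    simp only [cross2, Pi.sub_apply]; ring
  rwa [e] at h

/-- **The smooth stratum by data.**  If the HODOGRAPH polygon `z ↦ a (z + 1) − a z` is in strict convex position in its order
(either orientation) then the hodograph is convexly ordered — the hypothesis of `…TotalsLawHodograph*` (`q ≥ 3`). [folklore] -/
theorem convexlyOrdered_edgeVec_of_strictlyConvex {a : ZMod q → (Fin 2 → ℝ)} (hq : 3 ≤ q)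
    (h : StrictlyConvexCcw (edgeVec a) ∨ StrictlyConvexCw (edgeVec a)) : ConvexlyOrdered (edgeVec a) :=
  h.elim (fun h => convexlyOrdered_of_strictlyConvexCcw h hq) fun h => convexlyOrdered_of_strictlyConvexCw h hq

/-! ### Integer data: the hypothesis is decidable -/
/-- The real curve of an integer curve. -/
def intCurve (P : ZMod q → ℤ × ℤ) : ZMod q → (Fin 2 → ℝ) := fun z => ![((P z).1 : ℝ), ((P z).2 : ℝ)]

/-- Integer cross product of the edge `z → z+1` against the vertex `x`. -/
def intCross (P : ZMod q → ℤ × ℤ) (z x : ZMod q) : ℤ :=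
  ((P (z + 1)).1 - (P z).1) * ((P x).2 - (P z).2) - ((P (z + 1)).2 - (P z).2) * ((P x).1 - (P z).1)

omit [NeZero q] in
/-- The real cross product of the integer curve is the cast of the integer one. [folklore] -/
theorem cross2_intCurve (P : ZMod q → ℤ × ℤ) (z x : ZMod q) :
    cross2 (intCurve P (z + 1) - intCurve P z) (intCurve P x - intCurve P z) = (intCross P z x : ℝ) := by
  simp [cross2, intCurve, intCross]

omit [NeZero q] in
/-- Decidable form of strict ccw convex position for integer data. [folklore] -/
theorem strictlyConvexCcw_intCurve {P : ZMod q → ℤ × ℤ} (h : ∀ z x : ZMod q, x ≠ z → x ≠ z + 1 → 0 < intCross P z x) :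
    StrictlyConvexCcw (intCurve P) := by
  intro z x hx0 hx1; rw [cross2_intCurve]; exact_mod_cast h z x hx0 hx1

omit [NeZero q] in
/-- Decidable form of strict cw convex position for integer data. [folklore] -/
theorem strictlyConvexCw_intCurve {P : ZMod q → ℤ × ℤ} (h : ∀ z x : ZMod q, x ≠ z → x ≠ z + 1 → intCross P z x < 0) :
    StrictlyConvexCw (intCurve P) := by
  intro z x hx0 hx1; rw [cross2_intCurve]; exact_mod_cast h z x hx0 hx1

omit [NeZero q] in
/-- The hodograph of an integer curve is the integer curve of the integer hodograph. [folklore] -/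
theorem edgeVec_intCurve (P : ZMod q → ℤ × ℤ) :
    edgeVec (intCurve P) = intCurve fun z => ((P (z + 1)).1 - (P z).1, (P (z + 1)).2 - (P z).2) := by
  funext z
  ext t; fin_cases t <;> simp [edgeVec, intCurve]

end ConvexPosition

end TotalsLaw

end Summit.ValiantsHypothesis.ValiantsHypothesis.Theorems.NewtonUnitEquationsDissociatedUniform
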